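/-
Copyright (c) 2026 the pub-hodgecm-mathlib formalisation cell (harness21).  Prover seat hodgecm-mathlib-K2E3-p06 (g5), Track B «K2-LIT», engine E3, unit U4 «Keys»; deal (D61)
LINE LEAD of the open leaf (U4f-χ₁-ram-one), design D-I, plan DESIGN-B v1 step (B2) «IWAHORI MEMBERSHIP OF THE TWO SMALL CELLS OF `N`» on `U(Φ₃)(L⁺_v)`;
2026-09-04.  KERNEL module: THEOREMS ONLY (no definition, no named fact, no `sorry`, no instance, no notation).
-/
import Summits.HodgeConjecture.HodgeConjecture.Theorems.K2E3BranchALettersCM               -- ★ Z2A-3c (i) p858406 (K2E3-p06 g4): `symm_mem_of_mem_inf`; brings ★ Z2A-3b (`coe_eA_apply`, `map_weyl_eq_weylLongU`, `map_mem_unipotentU_of_mem`), the frame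
import Summits.HodgeConjecture.HodgeConjecture.Theorems.F0P3cStCharTSStLevelsTransport      -- ★ (LH4): `mem_K0_iff_mem_integralLevel` (`K0 = K_v`)
import Summits.HodgeConjecture.HodgeConjecture.Theorems.K2E3SphericalCellFunction           -- ★ I-3a p855288 (K2E3-p04): `unipotent_mem_cmLocalIntegralLevel_of_height_le_one`, `weylElt_mem_cmLocalIntegralLevel`
import Literature.NumberTheory.Automorphic.UnitaryIwahoriSubgroupThree                       -- ★ `mem_inf_of_mem_unipotentU_of_mem_glInt_subgroupOf`, `mem_glInt_inf_conj_glInt_of_v_lt_one`, `coe_weylLongU_mul_mul_weylLongU_apply'`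
import HarnessLib

/-!
# K2 ∕ E3 «EllipticInputs», unit U4 «Keys» — (U4f-χ₁-ram-one) step (B2) of DESIGN-B: THE SMALL CELLS OF `N(L⁺_v)` LIE IN THE IWAHORI
# «`‖u₀₂‖ ≤ 1 ⟹ u ∈ I`» and «`‖u₀₂‖ < 1 ⟹ w₀ u w₀ ∈ I`»; `θ = 1` on `N`   [BruhatTits1972 (4.4.4); Casselman1995 Prop. 1.4.4; Rogawski1990 §1.10]

Cell hodgecm-mathlib (D-0151), FLOOR 0, Track B «K2-LIT», engine E3, crux item H413 = stmt-HodgeConjecture-24833 (route `HCCMUnconditional`, no route verbs); target BY NAME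
the OPEN leaf `…K2E3EllipticInputs.U4Keys.sig_K2E3KeysThmTwoContractingRamifiedCharOne` (U4Keys ED. 7; cand v5 leaf (U4f-χ₁-ram-one-d0B)), design D-I, plan `DESIGN-B-v1`
(`K2/K2E3-p06/g5/DESIGN-B-v1-BranchBDepthZero.K2E3-p06-g5.md`) step (B2).  Author K2E3-p06 (g5), line lead (D61).  `--supports stmt-HodgeConjecture-24833 --as helper`; THEOREMS ONLY.
NOT THE PAYER: these are the membership letters behind the cell values (A1)–(A4) of the `(I, θ)`-type vector (step (B3)).

THE POINT.  In the (G3)-EXPLICIT frame `(w hw eA heA ϖ hϖ g₁ hg₁ K0 K1 I hK0 hK1 hI)` of ★ p857330 §3 (`I = K₀ ⊓ K₁` the Iwahori, `K₀ = K_v` ★ `mem_K0_iff_mem_integralLevel`),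
for `u ∈ N(L⁺_v)` with height `m(u) = Π_{w′} |(u₀₂)_{w′}|` (★ shells of `K2E3SphericalCFunctionShellExpansion`):
* §1 **`mem_of_height_le_one`** — `m(u) ≤ 1 ⟹ u ∈ I`: `u ∈ K_v` (★ `unipotent_mem_cmLocalIntegralLevel_of_height_le_one`), and an upper unitriangular element of `K₀` is in `I`
  (place model ★ `mem_inf_of_mem_unipotentU_of_mem_glInt_subgroupOf`; transport ★ `map_mem_unipotentU_of_mem`, ★ `symm_mem_of_mem_inf`).
* §2 **`weyl_mul_mul_weyl_mem_of_height_lt_one`** — `m(u) < 1 ⟹ w₀ u w₀ ∈ I` (`w₀ u w₀ ∈ K_v` as `w₀ ∈ K_v` ★; its place-model `(2,0)` entry is `(u₀₂)_w` ★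
  `coe_weylLongU_mul_mul_weylLongU_apply'`, of valuation `< 1`; the Hermitian upgrade ★ `mem_glInt_inf_conj_glInt_of_v_lt_one`); also as `w₀ u w₀⁻¹ ∈ I` (`w₀² = 1`).
* §3 **`theta_eq_one_of_mem_N`** — `θ(n) = 1` for `n ∈ N` (`n₀₀ = 1`), `θ(g) = χ₁(g₀₀)` (if a unit, else `0`) the depth-zero Iwahori character of ★ Z2A-1∕3b.
HONEST LABEL: HC_CM is proved only modulo the 7 printed citations (2 remaining named inputs: hLiu418 = stmt-HodgeConjecture-24832, h413 = stmt-HodgeConjecture-24833)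
until rung 0 closes; count-neutral — this file does NOT pay the leaf; no printed citation is discharged.

## References
* [BruhatTits1972] F. Bruhat, J. Tits, Publ. Math. IHÉS 41 (1972), (4.4.3)–(4.4.4) (the Iwahori subgroup and its big-cell factorisation).
* [Casselman1995] W. Casselman, *Introduction to the theory of admissible representations of `p`-adic reductive groups* (1995), Prop. 1.4.4, §6.4.
* [Rogawski1990] J. D. Rogawski, *Automorphic Representations of Unitary Groups in Three Variables* (1990), §1.10 p. 9, §4.5 p. 45.
* [PlatonovRapinchuk1994] V. Platonov, A. Rapinchuk, *Algebraic Groups and Number Theory* (1994), §5.1 (integral points of the one-place model).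
-/

set_option autoImplicit false
-- the mandated namespace has the single-problem summit's repeated segment (`HodgeConjecture.HodgeConjecture`)
set_option linter.dupNamespace false

noncomputable section

open NumberField IsDedekindDomain MeasureTheory
open scoped Matrix MatrixGroups WithZero Valued NNReal
open Literature.NumberTheory Literature.NumberTheory.Automorphic Literature.NumberTheory.Automorphic.UnitaryGroup
open Literature.NumberTheory.Rogawski1990 Literature.NumberTheory.GaloisRepresentations Literature.NumberTheory.GaloisRepresentations.IsNonarchimedeanLocalField

namespace Summit.HodgeConjecture.HodgeConjecture.Cruxes.H413.K2E3IwahoriCellMembership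

open Summit.HodgeConjecture.HodgeConjecture.Cruxes.H413
open Summit.HodgeConjecture.HodgeConjecture.Cruxes.H413.K2E3DepthZeroIwahoriCharacterCM
open Summit.HodgeConjecture.HodgeConjecture.Cruxes.H413.K2E3BranchALettersCM

variable (L : Type) [Field L] [NumberField L] [IsCMField L] (v : HeightOneSpectrum (𝓞 ↥(maximalRealSubfield L)))
  (w : PlacesOver L v) (hw : IsCMField.complexConj L • w.1 = w.1)
  (eA : Gqs L v ≃ₜ* ↥(unitaryGroupOfForm (galAdicCompletionMap (L := L) (IsCMField.complexConj L) hw) ((StdForm.antidiagonal 3).over (w.1.adicCompletion L))))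
  (heA : ∀ g : Gqs L v,
    ((eA g : ↥(unitaryGroupOfForm (galAdicCompletionMap (L := L) (IsCMField.complexConj L) hw) ((StdForm.antidiagonal 3).over (w.1.adicCompletion L)))) :
        GL (Fin 3) (w.1.adicCompletion L)) =
      ((localNonsplitEquiv (IsCMField.complexConj L) (qsForm L) (IsCMField.complexConj_ne_one L) w hw g :
        ↥(unitaryGroupOfForm (galAdicCompletionMap (L := L) (IsCMField.complexConj L) hw) (placeForm (qsForm L) w.1))) : GL (Fin 3) (w.1.adicCompletion L)))
  {ϖ : w.1.adicCompletion L} (hϖ : Valued.v ϖ = WithZero.exp (-1 : ℤ))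
  (g₁ : GL (Fin 3) (w.1.adicCompletion L)) (hg₁ : (g₁ : Matrix (Fin 3) (Fin 3) (w.1.adicCompletion L)) = Matrix.diagonal ![(1 : w.1.adicCompletion L), 1, ϖ])
  (K0 K1 I : Subgroup (Gqs L v))
  (hK0 : K0 = ((glInt 3 (w.1.adicCompletion L)).subgroupOf
    (unitaryGroupOfForm (galAdicCompletionMap (L := L) (IsCMField.complexConj L) hw) ((StdForm.antidiagonal 3).over (w.1.adicCompletion L)))).comap
      eA.toMulEquiv.toMonoidHom)
  (hK1 : K1 = (((glInt 3 (w.1.adicCompletion L)).map (MulAut.conj g₁).toMonoidHom).subgroupOf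
    (unitaryGroupOfForm (galAdicCompletionMap (L := L) (IsCMField.complexConj L) hw) ((StdForm.antidiagonal 3).over (w.1.adicCompletion L)))).comap
      eA.toMulEquiv.toMonoidHom)
  (hI : I = K0 ⊓ K1)
  (t : ParabolicTriple (Gqs L v)) (ht : t = cmBorelTriple L 3 v)
  (w₀ : Gqs L v) (hw₀ : Units.val (w₀.val : GL (Fin 3) (LocalRing L v)) = cmLocalForm L 3 v)

/-! ## §1 `m(n) ≤ 1 ⟹ n ∈ I` -/

include hw heA hϖ hg₁ hK0 hK1 hI ht in
/-- **`m(n) ≤ 1 ⟹ n ∈ I`.**  `n ∈ N(L⁺_v)` (`t = cmBorelTriple`, letter `ht`) with `Π_{w′} |(n₀₂)_{w′}| ≤ 1` lies in `K_v` (★ `unipotent_mem_cmLocalIntegralLevel_of_height_le_one`), i.e. in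
`K₀` (★ `mem_K0_iff_mem_integralLevel`); `eA n` is upper unitriangular (★ `map_mem_unipotentU_of_mem`) and integral, hence in the place-model Iwahori (★
`mem_inf_of_mem_unipotentU_of_mem_glInt_subgroupOf`: the three strictly-lower entries vanish), i.e. `n ∈ I = K₀ ⊓ K₁`. [cite: BruhatTits1972, (4.4.4)] [cite: Rogawski1990, §4.5 p. 45] -/
theorem mem_of_height_le_one {n : Gqs L v} (hn : n ∈ t.N)
    (hu : (∏ w' : PlacesOver L v, normAbs (w'.1.adicCompletion L) (((n.val : GL (Fin 3) (LocalRing L v)) : Matrix (Fin 3) (Fin 3) (LocalRing L v)) 0 2 w')) ≤ 1) :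
    n ∈ I := by
  subst ht
  have hKv : n ∈ cmLocalIntegralLevel L 3 (qsForm L) v :=
    K2E3SphericalCellFunction.unipotent_mem_cmLocalIntegralLevel_of_height_le_one L v w hw ⟨n, hn⟩ hu
  have hK0n : n ∈ K0 := (F0P3cStCharTSStLevelsTransport.mem_K0_iff_mem_integralLevel L v w hw eA heA K0 hK0 n).2 hKv
  have hint : eA n ∈ (glInt 3 (w.1.adicCompletion L)).subgroupOf
        (unitaryGroupOfForm (galAdicCompletionMap (L := L) (IsCMField.complexConj L) hw) ((StdForm.antidiagonal 3).over (w.1.adicCompletion L))) := by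
    rw [hK0] at hK0n
    exact hK0n
  have hN : eA n ∈ unipotentU (galAdicCompletionMap (L := L) (IsCMField.complexConj L) hw) ((StdForm.antidiagonal 3).over (w.1.adicCompletion L)) :=
    map_mem_unipotentU_of_mem L v w hw eA heA (cmBorelTriple L 3 v) rfl hn
  have hIw := mem_inf_of_mem_unipotentU_of_mem_glInt_subgroupOf (galAdicCompletionMap (L := L) (IsCMField.complexConj L) hw)
    (rfl : (StdForm.antidiagonal 3).over (w.1.adicCompletion L) = _)
    (fun x => valued_galAdicCompletionMap (L := L) (IsCMField.complexConj L) hw x) hϖ g₁ hg₁ hN hint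
  have h := symm_mem_of_mem_inf L v w hw eA g₁ K0 K1 I hK0 hK1 hI hIw
  rwa [ContinuousMulEquiv.symm_apply_apply] at h

/-! ## §2 `m(n) < 1 ⟹ w₀ n w₀ ∈ I` -/

include hw heA hϖ hg₁ hK0 hK1 hI ht hw₀ in
/-- **`m(n) < 1 ⟹ w₀ n w₀ ∈ I`.**  `w₀ ∈ K_v` (★ `weylElt_mem_cmLocalIntegralLevel`) and `n ∈ K_v` (§1's first step), so `w₀ n w₀ ∈ K_v = K₀`; in the place model
`eA(w₀ n w₀) = w · eA n · w` (★ `map_weyl_eq_weylLongU`) has `(2,0)` entry `(eA n)₀₂ = (n₀₂)_w` (★ `coe_weylLongU_mul_mul_weylLongU_apply'`, ★ `coe_eA_apply`), of valuation `< 1`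
(`Π |(n₀₂)_{w′}| = |(n₀₂)_w|` ★ `prod_normAbs_eq_normAbs_apply`, ★ `normAbs_lt_one_iff`); the Hermitian upgrade ★ `mem_glInt_inf_conj_glInt_of_v_lt_one` puts it in the Iwahori.
[cite: BruhatTits1972, (4.4.4)] [cite: Casselman1995, Prop. 1.4.4] [cite: Rogawski1990, §1.10 p. 9] -/
theorem weyl_mul_mul_weyl_mem_of_height_lt_one {n : Gqs L v} (hn : n ∈ t.N)
    (hu : (∏ w' : PlacesOver L v, normAbs (w'.1.adicCompletion L) (((n.val : GL (Fin 3) (LocalRing L v)) : Matrix (Fin 3) (Fin 3) (LocalRing L v)) 0 2 w')) < 1) :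
    w₀ * n * w₀ ∈ I := by
  subst ht
  -- `w₀ n w₀ ∈ K_v = K₀`
  have huKv : n ∈ cmLocalIntegralLevel L 3 (qsForm L) v :=
    K2E3SphericalCellFunction.unipotent_mem_cmLocalIntegralLevel_of_height_le_one L v w hw ⟨n, hn⟩ hu.le
  have hwKv : w₀ ∈ cmLocalIntegralLevel L 3 (qsForm L) v :=
    K2E3SphericalCellFunction.weylElt_mem_cmLocalIntegralLevel L v w hw w₀ hw₀
  have hK0x : w₀ * n * w₀ ∈ K0 :=
    (F0P3cStCharTSStLevelsTransport.mem_K0_iff_mem_integralLevel L v w hw eA heA K0 hK0 _).2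
      (Subgroup.mul_mem _ (Subgroup.mul_mem _ hwKv huKv) hwKv)
  have hint : eA (w₀ * n * w₀) ∈ (glInt 3 (w.1.adicCompletion L)).subgroupOf
        (unitaryGroupOfForm (galAdicCompletionMap (L := L) (IsCMField.complexConj L) hw) ((StdForm.antidiagonal 3).over (w.1.adicCompletion L))) := by
    rw [hK0] at hK0x
    exact hK0x
  -- the `(2,0)` entry of `w · eA n · w` is `(n₀₂)_w`, of valuation `< 1`
  have hwL := map_weyl_eq_weylLongU L v w hw eA heA w₀ hw₀
  have h20 : (((eA (w₀ * n * w₀) : ↥(unitaryGroupOfForm (galAdicCompletionMap (L := L) (IsCMField.complexConj L) hw) ((StdForm.antidiagonal 3).over (w.1.adicCompletion L)))) :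
        GL (Fin 3) (w.1.adicCompletion L)) : Matrix (Fin 3) (Fin 3) (w.1.adicCompletion L)) 2 0 =
      ((n.val : GL (Fin 3) (LocalRing L v)) : Matrix (Fin 3) (Fin 3) (LocalRing L v)) 0 2 w := by
    rw [map_mul, map_mul, hwL, coe_weylLongU_mul_mul_weylLongU_apply', coe_eA_apply L v w hw eA heA]
    rfl
  have hv20 : Valued.v ((((eA (w₀ * n * w₀) : ↥(unitaryGroupOfForm (galAdicCompletionMap (L := L) (IsCMField.complexConj L) hw) ((StdForm.antidiagonal 3).over (w.1.adicCompletion L)))) :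
        GL (Fin 3) (w.1.adicCompletion L)) : Matrix (Fin 3) (Fin 3) (w.1.adicCompletion L)) 2 0) < 1 := by
    rw [h20, v_lt_one_iff_valuation_lt_one, ← normAbs_lt_one_iff, ← F0P3cStCharTSLocalRingNormDictionary.prod_normAbs_eq_normAbs_apply L v w hw]
    exact hu
  have hIw := mem_glInt_inf_conj_glInt_of_v_lt_one (galAdicCompletionMap (L := L) (IsCMField.complexConj L) hw)
    (rfl : (StdForm.antidiagonal 3).over (w.1.adicCompletion L) = _)
    (fun x => valued_galAdicCompletionMap (L := L) (IsCMField.complexConj L) hw x) hϖ g₁ hg₁ hint hv20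
  have h := symm_mem_of_mem_inf L v w hw eA g₁ K0 K1 I hK0 hK1 hI hIw
  rwa [ContinuousMulEquiv.symm_apply_apply] at h

include hw heA hϖ hg₁ hK0 hK1 hI ht hw₀ in
/-- **`m(n) < 1 ⟹ w₀ n w₀⁻¹ ∈ I`** (§2 with `w₀⁻¹ = w₀`, `w₀² = 1`): the lower unipotent `w₀ n w₀⁻¹ ∈ N̄` with small corner entry lies in `I ∩ N̄`. [cite: BruhatTits1972, (4.4.4)] -/
theorem weyl_mul_mul_weyl_inv_mem_of_height_lt_one {n : Gqs L v} (hn : n ∈ t.N)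
    (hu : (∏ w' : PlacesOver L v, normAbs (w'.1.adicCompletion L) (((n.val : GL (Fin 3) (LocalRing L v)) : Matrix (Fin 3) (Fin 3) (LocalRing L v)) 0 2 w')) < 1) :
    w₀ * n * w₀⁻¹ ∈ I := by
  -- `w₀⁻¹ = w₀` (`eA w₀ = w` ★ `map_weyl_eq_weylLongU`, `w · w = 1` ★ `weylLongU_mul_weylLongU`; cf. ★ `F0P3cStCharTSDomGeneralH.weylElt₂_inv` in rank 2)
  have hinv : w₀⁻¹ = w₀ :=
    inv_eq_of_mul_eq_one_right (eA.injective (by rw [map_mul, map_one, map_weyl_eq_weylLongU L v w hw eA heA w₀ hw₀, weylLongU_mul_weylLongU]))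
  rw [hinv]
  exact weyl_mul_mul_weyl_mem_of_height_lt_one L v w hw eA heA hϖ g₁ hg₁ K0 K1 I hK0 hK1 hI t ht w₀ hw₀ hn hu

/-! ## §3 `θ = 1` on `N` -/

open Classical in
include ht in
/-- **`θ(n) = 1` for `n ∈ N(L⁺_v)`** (`n₀₀ = 1` for an upper unitriangular `n`), `θ(g) := if h : IsUnit g₀₀ then χ₁(h.unit) else 0` the depth-zero Iwahori character of ★ Z2A-1∕3b —
so an `(I, θ)`-eigen section satisfies `f(g n) = f(g)` for `n ∈ N ∩ I`. [cite: MoyPrasad1996, §3] [cite: Rogawski1990, §1.10 p. 9] -/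
theorem theta_eq_one_of_mem_N (χ₁ : (LocalRing L v)ˣ →* ℂˣ) {n : Gqs L v} (hn : n ∈ t.N) :
    (if h : IsUnit (((n.val : GL (Fin 3) (LocalRing L v)) : Matrix (Fin 3) (Fin 3) (LocalRing L v)) 0 0) then ((χ₁ h.unit : ℂˣ) : ℂ) else 0) = 1 := by
  subst ht
  have h00 : ((n.val : GL (Fin 3) (LocalRing L v)) : Matrix (Fin 3) (Fin 3) (LocalRing L v)) 0 0 = 1 :=
    ((mem_unipotentU_iff (σ := conjLocal L (IsCMField.complexConj L) v) (J := cmLocalForm L 3 v) n).1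
      (show n ∈ unipotentU (conjLocal L (IsCMField.complexConj L) v) (cmLocalForm L 3 v) from hn)).2 0
  have h1 : IsUnit (((n.val : GL (Fin 3) (LocalRing L v)) : Matrix (Fin 3) (Fin 3) (LocalRing L v)) 0 0) := by rw [h00]; exact isUnit_one
  have hunit : h1.unit = 1 := Units.ext (by rw [IsUnit.unit_spec, h00, Units.val_one])
  rw [dif_pos h1, hunit, map_one, Units.val_one]

end Summit.HodgeConjecture.HodgeConjecture.Cruxes.H413.K2E3IwahoriCellMembership

end
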